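import Literature.NumberTheory.EllipticCurves.BSDSelmerParityMonskyProofs
import Literature.NumberTheory.EllipticCurves.BSDSelmerParityDokchitserMurtyMurtyProofs
import HarnessLib

/-!
# Monsky's Lemma 1.1 from Hoffstein–Luo and Modularity; the `2`-parity fact over `ℚ` modulo Kramer

Second proof companion of the named fact
`Literature.NumberTheory.EllipticCurves.monsky_selmerCorank_two_mod_two_eq`
(`BSDSelmerParityDokchitserProofs.lean`): for every elliptic curve `E/ℚ`,
`corank_{ℤ_2} Sel_{2^∞}(E/ℚ) ≡ ord_{s=1} L(E, s) (mod 2)` — step (0) of T. Dokchitser,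
V. Dokchitser, Ann. of Math. 172 (2010), proof of Thm. 4.19 (= Thm. 1.4): "For `p = 2` this is due
to Monsky [26]", [26] = P. Monsky, *Generalizing the Birch–Stephens theorem. I. Modular curves*,
Math. Z. 221 (1996), 415–420, Thm. 1.5. `BSDSelmerParityMonskyProofs` proves the fact along
Monsky's printed proof (`monsky_selmerCorank_two_mod_two_eq_of_facts`) from Gross–Zagier–Kolyvagin,
the Cassels–Tate pairing, the entire continuation of `L(E, s)`, and Monsky's two printed inputs
that the tree does not carry, taken there as hypotheses:

* `h11` = **Lemma 1.1** (p. 416; Waldspurger, Forum Math. 3 (1991), Thm. 4): "If `W(E) = 1` there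
  is a good real twist, `Ẽ`, of `E` with `L_Ẽ(1) ≠ 0`. If `W(E) = −1` there is a good imaginary
  twist, `Ẽ`, of `E` with `L_Ẽ(1) ≠ 0`" — a quadratic field `K` is "`E`-good" if `2` and all primes
  of bad reduction of `E` split in `K` (p. 416, `l = 2`), `Ẽ` is the twist of `E` by `K`, and
  `W(E) = (−1)^{R(E)}` is the analytic root number (p. 415);
* `h14` = **Lemma 1.4(b)** for `F = ℚ` (p. 417; Kramer, Trans. AMS 264 (1981), Thm. 1 and Prop. 3).

This file **proves `h11`** from two named facts the tree already carries —

* `Literature.NumberTheory.EllipticCurves.ModularForms.exists_isNewformOf` — the Modularity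
  Theorem (Breuil–Conrad–Diamond–Taylor 2001, Thm. A; Monsky's standing hypothesis "`E` modular");
* `Literature.NumberTheory.EllipticCurves.HoffsteinLuo1997_exists_twist_L_one_ne_zero` —
  Hoffstein–Luo, Math. Res. Lett. 4 (1997), Theorem with its "moreover" clause: for every `E/ℚ`,
  finite `S` and bound `B` a square-free `d ≡ 1 (mod 8)`, `|d| > B`, `(d/ℓ) = 1` for the odd
  `ℓ ∈ S`, with `L(E^{(d)}, 1) ≠ 0` (`NonvanishingTwistsHoffsteinLuo.lean`) —

so that the `2`-parity fact over `ℚ` is reduced to pre-existing named facts of the tree plus the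
single printed input `h14` (`monsky_selmerCorank_two_mod_two_eq_of_kramer`). Monsky himself
allows exactly this substitution of the analytic source: Lemma 1.3 cites "Murty–Murty (or
Bump–Friedberg–Hoffstein)" next to Waldspurger, and Hoffstein–Luo's theorem is the sieve refinement
of those mean-value theorems with prescribed quadratic characters at a finite set of primes.

## The argument (Hoffstein–Luo ⇒ Lemma 1.1)

Let `N = N_E` and apply Hoffstein–Luo with `S ⊇ {2} ∪ {ℓ ∣ N}`: a square-free `d ≡ 1 (mod 8)`,
`|d| > 1`, with `(d/ℓ) = 1` for every odd `ℓ ∣ N` and `L(E^{(d)}, 1) ≠ 0`. The sign of the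
functional equation of `L(E^{(d)}, s) = L(E ⊗ χ_d, s)` is `w(E) χ_d(−1) χ_d(N) = w(E) · sgn d`
(Murty–Murty 1997, Ch. 6, §1, p. 96; in the tree from Modularity,
`entireLFunction_quadraticTwist_one_eq_zero_of_pos` / `_of_neg`), so `L(E^{(d)}, 1) ≠ 0` forces
`sgn d = w(E)`: **`d > 0` if `w(E) = +1`** (`exists_pos_fundamental_twist_ne_zero_of_hoffsteinLuo`,
`BSDSelmerParityDokchitserMurtyMurtyProofs`) and **`d < 0` if `w(E) = −1`**
(`exists_neg_fundamental_twist_ne_zero_of_hoffsteinLuo`, packaged with the extra split prime `2` as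
`friedbergHoffstein_exists_heegnerField_split_twist_ne_zero_of_hoffsteinLuo`,
`NonvanishingTwistsWaldspurgerOfHoffsteinLuo`). The field `K = ℚ(√d)` has discriminant `d`
(`QuadraticFields.Quadratic.exists_numberField_discr_eq`), is real quadratic for `d > 0`
(`isTotallyReal_of_finrank_eq_two_of_discr_pos`: `sgn d_K = (−1)^{r₂}`, Mathlib
`NumberField.sign_discr`) and imaginary quadratic for `d < 0`, and `2` and every `ℓ ∣ N` split in
`K` (`d ≡ 1 (mod 8)`, `(d/ℓ) = 1`: the decomposition law, `satisfiesHeegnerHypothesis_iff_kronecker`);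
its twist `Ẽ = E^{(d_K)} = E^{(d)}` has `L(Ẽ, 1) ≠ 0`. This is Lemma 1.1 indexed by the sign
`w(E)`; Monsky's `W(E) = (−1)^{R(E)}` agrees with `w(E)` by the functional equation
(`even_analyticRank_iff_rootNumber_eq_one_of_exists_isNewformOf`, Modularity), whence Lemma 1.1 as
consumed by `monsky_selmerCorank_two_mod_two_eq_of_facts` (`monsky_lemma_1_1_of_hoffsteinLuo`, via
`monsky_lemma_1_1_of_rootNumber_form`).

## What is proved here (theorems only; no definition, no named fact — D-0026)

* `isTotallyReal_of_finrank_eq_two_of_discr_pos` — a quadratic field with `d_K > 0` is totally real;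
* `exists_realQuadraticField_split_twist_ne_zero_of_hoffsteinLuo` — Lemma 1.1, case `w(E) = +1`
  (a good REAL twist with `L(Ẽ, 1) ≠ 0`), from Modularity and Hoffstein–Luo;
* `exists_imaginaryQuadraticField_split_twist_ne_zero_of_hoffsteinLuo` — Lemma 1.1, case
  `w(E) = −1` (a good IMAGINARY twist with `L(Ẽ, 1) ≠ 0`), from the same;
* `monsky_lemma_1_1_of_hoffsteinLuo` — Lemma 1.1 in Monsky's terms (`W(E) = (−1)^{R(E)}`);
* `monsky_selmerCorank_two_mod_two_eq_of_kramer` — **the named fact from pre-existing named facts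
  of the tree and Lemma 1.4(b) alone**: Modularity (`exists_isNewformOf`), Hoffstein–Luo
  (`HoffsteinLuo1997_exists_twist_L_one_ne_zero`), Gross–Zagier–Kolyvagin
  (`rank_eq_analyticRank_of_analyticRank_le_one`), the Cassels–Tate pairing over number fields
  (`WeierstrassCurve.exists_casselsTate_pairing`), and `h14`.

`monsky_selmerCorank_two_mod_two_eq_holds` is still NOT here: the four named facts above are
undischarged in the tree, and Lemma 1.4(b) — Kramer's parity formula
`(−1)^{s_2(E, L)} = ∏_v (−1)^{i_v(E)}` (Kramer 1981, Thm. 1; Monsky's Thm. 2.2) with the local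
norm indices at odd good places (Kramer Prop. 3, Mazur 1972; Monsky's Thm. 2.1) and the product
formula for the norm-residue symbol — is not in the tree (a proof file may not vendor it, D-0026).

## References

* [Monsky1996] P. Monsky, *Generalizing the Birch–Stephens theorem. I. Modular curves*, Math. Z.
  221 (1996), 415–420: p. 415 (`s_l`, `R(E)`, `W(E)`), §1 p. 416 (good twists; Lemmas 1.1–1.3),
  p. 417 (Lemma 1.4, Theorem 1.5).
* [HoffsteinLuo1997] J. Hoffstein, W. Luo, *Nonvanishing of `L`-series and the combinatorial
  sieve*, Math. Res. Lett. 4 (1997), Theorem (§1, pp. 435–436).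
* [Waldspurger1991] J.-L. Waldspurger, *Correspondances de Shimura et quaternions*, Forum Math. 3
  (1991), 219–307, Thm. 4 (Monsky's [11]).
* [MurtyMurty1997] M. R. Murty, V. K. Murty, *Non-vanishing of `L`-functions and applications*,
  Progress in Math. 157 (1997), Ch. 6, §1 and p. 96 (sign of the functional equation of `L_D`).
* [Kramer1981] K. Kramer, *Arithmetic of elliptic curves upon quadratic extension*, Trans. Amer.
  Math. Soc. 264 (1981), 121–135, Thm. 1 and Prop. 3 (Monsky's [7]).
* [BCDTJAMS2001] C. Breuil, B. Conrad, F. Diamond, R. Taylor, J. Amer. Math. Soc. 14 (2001), Thm. A.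
* [DokchitserDokchitserAnnals2010] T. Dokchitser, V. Dokchitser, Ann. of Math. 172 (2010), §4.6,
  proof of Thm. 4.19 (= Thm. 1.4): "For `p = 2` this is due to Monsky [26]".
-/

noncomputable section

open scoped Classical NumberTheorySymbols
open scoped AddSubgroup

open WeierstrassCurve NumberField NumberField.InfinitePlace
  Literature.NumberTheory.EllipticCurves.ModularForms

namespace Literature.NumberTheory.EllipticCurves

/-! ### Real quadratic fields -/

/-- **A quadratic field of positive discriminant is totally real** (Cox, *Primes of the form
`x² + ny²*, 2nd ed., p. 119: "Quadratic fields come in two flavors, real (`d_K > 0`) and imaginary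
(`d_K < 0`)"): `sgn d_K = (−1)^{r₂}` (Mathlib `NumberField.sign_discr`) and `r₁ + 2 r₂ = 2`
(`card_add_two_mul_card_eq_rank`) give `r₂ = 0` when `d_K > 0`. Companion of
`isImaginaryQuadratic_iff_discr_neg` (`HeegnerPointsImaginaryQuadraticProofs`). [folklore] -/
theorem isTotallyReal_of_finrank_eq_two_of_discr_pos {K : Type*} [Field K] [NumberField K]
    (h2 : Module.finrank ℚ K = 2) (hd : 0 < NumberField.discr K) : IsTotallyReal K := by
  rw [← nrComplexPlaces_eq_zero_iff]
  have hsign := NumberField.sign_discr K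
  rw [Int.sign_eq_one_of_pos hd] at hsign
  have heven : Even (nrComplexPlaces K) := by
    by_contra h
    rw [Nat.not_even_iff_odd] at h
    rw [h.neg_one_pow] at hsign
    norm_num at hsign
  have hrk := card_add_two_mul_card_eq_rank K
  rw [h2] at hrk
  obtain ⟨m, hm⟩ := heven
  omega

/-! ### Lemma 1.1, case `W(E) = 1`: a good real twist (Hoffstein–Luo, `d > 0`) -/

/-- **Monsky's Lemma 1.1, case `w(E) = +1`, from Modularity and Hoffstein–Luo** ("If `W(E) = 1`
there is a good real twist, `Ẽ`, of `E` with `L_Ẽ(1) ≠ 0`", Math. Z. 221, p. 416; Monsky cites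
Waldspurger 1991, Thm. 4). For `E/ℚ` elliptic with `w(E) = +1` there is a real quadratic field `K`
(`[K : ℚ] = 2`, totally real) in which `2` and every prime dividing `N_E` split and whose twist
`Ẽ = E^{(d_K)}` has `L(Ẽ, 1) ≠ 0`. Proof: Hoffstein–Luo's square-free `d ≡ 1 (mod 8)`, `|d| > 1`,
with `(d/ℓ) = 1` at the odd `ℓ ∣ N_E` and `L(E^{(d)}, 1) ≠ 0` is positive for `w(E) = +1`
(`exists_pos_fundamental_twist_ne_zero_of_hoffsteinLuo`: a negative such `d` would give sign `−1`
and `L(E^{(d)}, 1) = 0`, Murty–Murty 1997, Ch. 6, p. 96), and `K = ℚ(√d)` has `d_K = d`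
(`QuadraticFields.Quadratic.exists_numberField_discr_eq`), is totally real
(`isTotallyReal_of_finrank_eq_two_of_discr_pos`), and `2`, `ℓ ∣ N_E` split in it
(`satisfiesHeegnerHypothesis_iff_kronecker`). [cite: Monsky1996, Lemma 1.1 (p. 416), case W(E) = 1]
[cite: HoffsteinLuo1997, Theorem (§1, pp. 435–436)] [cite: MurtyMurty1997, Ch. 6 §1, p. 96] -/
theorem exists_realQuadraticField_split_twist_ne_zero_of_hoffsteinLuo (hmod : exists_isNewformOf)
    (hHL : HoffsteinLuo1997_exists_twist_L_one_ne_zero) (W : WeierstrassCurve ℚ) [W.IsElliptic]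
    (hw : W.rootNumber = 1) :
    ∃ (K : Type) (_ : Field K) (_ : NumberField K),
      Module.finrank ℚ K = 2 ∧ IsTotallyReal K ∧ SatisfiesHeegnerHypothesis 2 K ∧
        SatisfiesHeegnerHypothesis (W.conductorNorm ℤ) K ∧
          (W.quadraticTwist (NumberField.discr K : ℚ)).entireLFunction 1 ≠ 0 := by
  obtain ⟨d, hdpos, hsq, hd8, hBd, -, hjacN, hL⟩ :=
    exists_pos_fundamental_twist_ne_zero_of_hoffsteinLuo hmod hHL W hw ∅ 1
  have hd1 : d ≠ 1 := by
    rintro rfl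
    simp at hBd
  obtain ⟨K, _, _, h2, hdK⟩ :=
    QuadraticFields.Quadratic.exists_numberField_discr_eq (D := d) (Or.inl ⟨by omega, hsq, hd1⟩)
  refine ⟨K, inferInstance, inferInstance, h2, ?_, ?_, ?_, ?_⟩
  · exact isTotallyReal_of_finrank_eq_two_of_discr_pos h2 (hdK ▸ hdpos)
  · rw [satisfiesHeegnerHypothesis_iff_kronecker 2 K h2, hdK]
    intro p hp hp2
    exact ⟨fun _ ↦ hd8, fun hne ↦ absurd ((Nat.prime_dvd_prime_iff_eq hp Nat.prime_two).mp hp2) hne⟩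
  · rw [satisfiesHeegnerHypothesis_iff_kronecker _ K h2, hdK]
    exact fun p hp hpN ↦ ⟨fun _ ↦ hd8, fun hne ↦ hjacN p hp hpN hne⟩
  · rw [hdK]
    exact hL

/-! ### Lemma 1.1, case `W(E) = −1`: a good imaginary twist (Hoffstein–Luo, `d < 0`) -/

/-- **Monsky's Lemma 1.1, case `w(E) = −1`, from Modularity and Hoffstein–Luo** ("If `W(E) = −1`
there is a good imaginary twist, `Ẽ`, of `E` with `L_Ẽ(1) ≠ 0`", Math. Z. 221, p. 416). For
`E/ℚ` elliptic with `w(E) = −1` there is an imaginary quadratic field `K` in which `2` and every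
prime dividing `N_E` split and whose twist `Ẽ = E^{(d_K)}` has `L(Ẽ, 1) ≠ 0`: the case `p = 2` of
`friedbergHoffstein_exists_heegnerField_split_twist_ne_zero_of_hoffsteinLuo` (Hoffstein–Luo's `d`
with `2` adjoined to `S` is negative for `w(E) = −1`, and `K = ℚ(√d)`).
[cite: Monsky1996, Lemma 1.1 (p. 416), case W(E) = −1] [cite: HoffsteinLuo1997, Theorem (§1, pp. 435–436)]
[cite: MurtyMurty1997, Ch. 6 §1, p. 96] -/
theorem exists_imaginaryQuadraticField_split_twist_ne_zero_of_hoffsteinLuo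
    (hmod : exists_isNewformOf) (hHL : HoffsteinLuo1997_exists_twist_L_one_ne_zero)
    (W : WeierstrassCurve ℚ) [W.IsElliptic] (hw : W.rootNumber = -1) :
    ∃ (K : Type) (_ : Field K) (_ : NumberField K),
      IsImaginaryQuadratic K ∧ SatisfiesHeegnerHypothesis 2 K ∧
        SatisfiesHeegnerHypothesis (W.conductorNorm ℤ) K ∧
          (W.quadraticTwist (NumberField.discr K : ℚ)).entireLFunction 1 ≠ 0 := by
  obtain ⟨K, _, _, hK, -, hN, h2, hL⟩ :=
    friedbergHoffstein_exists_heegnerField_split_twist_ne_zero_of_hoffsteinLuo hmod hHL W hw 2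
      Nat.prime_two 0
  exact ⟨K, _, _, hK, h2, hN, hL⟩

/-! ### Lemma 1.1 in Monsky's terms, and the `2`-parity fact modulo Lemma 1.4(b) -/

/-- **Monsky's Lemma 1.1 from Modularity and Hoffstein–Luo** (Math. Z. 221, p. 416: "If `W(E) = 1`
there is a good real twist, `Ẽ`, of `E` with `L_Ẽ(1) ≠ 0`. If `W(E) = −1` there is a good
imaginary twist, `Ẽ`, of `E` with `L_Ẽ(1) ≠ 0`"; `W(E) = (−1)^{R(E)}`, p. 415), in the
transcription consumed by `monsky_selmerCorank_two_mod_two_eq_of_facts` (hypothesis `h11` there):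
the two cases by the sign `w(E)` are
`exists_realQuadraticField_split_twist_ne_zero_of_hoffsteinLuo` and
`exists_imaginaryQuadraticField_split_twist_ne_zero_of_hoffsteinLuo`, and `Even R(E) ↔ w(E) = 1`
is `even_analyticRank_iff_rootNumber_eq_one_of_exists_isNewformOf` (Modularity), combined by
`monsky_lemma_1_1_of_rootNumber_form`. [cite: Monsky1996, Lemma 1.1 (p. 416) and p. 415 (W(E))]
[cite: HoffsteinLuo1997, Theorem (§1, pp. 435–436)] [cite: BCDTJAMS2001, Thm. A] -/
theorem monsky_lemma_1_1_of_hoffsteinLuo (hmod : exists_isNewformOf)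
    (hHL : HoffsteinLuo1997_exists_twist_L_one_ne_zero) (W : WeierstrassCurve ℚ) [W.IsElliptic] :
    (Even W.analyticRank → ∃ (K : Type) (_ : Field K) (_ : NumberField K),
        Module.finrank ℚ K = 2 ∧ IsTotallyReal K ∧ SatisfiesHeegnerHypothesis 2 K ∧
          SatisfiesHeegnerHypothesis (W.conductorNorm ℤ) K ∧
            (W.quadraticTwist (NumberField.discr K : ℚ)).entireLFunction 1 ≠ 0) ∧
      (Odd W.analyticRank → ∃ (K : Type) (_ : Field K) (_ : NumberField K),
        IsImaginaryQuadratic K ∧ SatisfiesHeegnerHypothesis 2 K ∧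
          SatisfiesHeegnerHypothesis (W.conductorNorm ℤ) K ∧
            (W.quadraticTwist (NumberField.discr K : ℚ)).entireLFunction 1 ≠ 0) :=
  monsky_lemma_1_1_of_rootNumber_form
    (fun W _ ↦ even_analyticRank_iff_rootNumber_eq_one_of_exists_isNewformOf W hmod)
    (fun W _ ↦ ⟨exists_realQuadraticField_split_twist_ne_zero_of_hoffsteinLuo hmod hHL W,
      exists_imaginaryQuadraticField_split_twist_ne_zero_of_hoffsteinLuo hmod hHL W⟩) W

/-- **The `2`-parity fact over `ℚ` from pre-existing named facts and Kramer's Lemma 1.4(b)**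
(Monsky, Math. Z. 221, Thm. 1.5, assembled as printed by
`monsky_selmerCorank_two_mod_two_eq_of_facts_of_exists_isNewformOf`, with Lemma 1.1 now PROVED from
Modularity and Hoffstein–Luo, `monsky_lemma_1_1_of_hoffsteinLuo`). Inputs: `hmod` — the Modularity
Theorem `exists_isNewformOf` (BCDT 2001; Monsky's "`E` modular"); `hHL` — Hoffstein–Luo 1997
(`HoffsteinLuo1997_exists_twist_L_one_ne_zero`; Lemma 1.1); `hGZK` — Gross–Zagier–Kolyvagin
(`rank_eq_analyticRank_of_analyticRank_le_one`; Lemma 1.3); `hCT` — the Cassels–Tate pairing over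
number fields (`WeierstrassCurve.exists_casselsTate_pairing`; `s_2 ≡ rk_2`, p. 416); and `h14` —
**Lemma 1.4(b) for `F = ℚ`** (p. 417; Kramer 1981, Thm. 1 and Prop. 3): for a quadratic field `K`
in which `2` and all primes dividing `N_E` split, `s_2(E, K) = rank E(K) + dim Ш(E/K)[2]`
(`#Ш(E/K)[2] = 2^u`) has the parity of the number of real places of `ℚ` not split in `K`, i.e. of
`r₂(K)`. So the named fact waits on the discharges of four pre-existing facts and on Lemma 1.4(b)
only. [cite: Monsky1996, Theorem 1.5 (p. 417), with Lemmas 1.1, 1.3, 1.4(b)]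
[cite: Kramer1981, Thm. 1 and Prop. 3] [cite: DokchitserDokchitserAnnals2010, §4.6, proof of Thm. 4.19 (case p = 2)] -/
theorem monsky_selmerCorank_two_mod_two_eq_of_kramer (hmod : exists_isNewformOf)
    (hHL : HoffsteinLuo1997_exists_twist_L_one_ne_zero)
    (hGZK : rank_eq_analyticRank_of_analyticRank_le_one)
    (hCT : ∀ (K : Type) [Field K] [NumberField K], exists_casselsTate_pairing (K := K))
    (h14 : ∀ (W : WeierstrassCurve ℚ) [W.IsElliptic] (K : Type) [Field K] [NumberField K],
      Module.finrank ℚ K = 2 → SatisfiesHeegnerHypothesis 2 K →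
        SatisfiesHeegnerHypothesis (W.conductorNorm ℤ) K →
          ∀ u : ℕ, Nat.card (((W.baseChange K).sha)[(2 : ℤ)]) = 2 ^ u →
            ((W.baseChange K).mordellWeilRank + u) % 2 = nrComplexPlaces K % 2) :
    monsky_selmerCorank_two_mod_two_eq :=
  monsky_selmerCorank_two_mod_two_eq_of_facts_of_exists_isNewformOf hmod hGZK hCT
    (fun W _ ↦ monsky_lemma_1_1_of_hoffsteinLuo hmod hHL W) h14

end Literature.NumberTheory.EllipticCurves

end
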